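import Literature.AlgebraicGeometry.AbelianSchemes.AbelianSchemeHomDescentKernelEq
import Literature.AlgebraicGeometry.AbelianSchemes.AbelianSchemeFixedPowBaseChange
import Literature.AlgebraicGeometry.GroupSchemes.GroupSchemeKernelBaseChange
import Literature.AlgebraicGeometry.Limits.SurjectiveSpread
import HarnessLib

/-!
# The quotient with given kernel commutes with base change: `(A ⁄ G)_{S′}` is THE quotient of `A_{S′}` by `G_{S′}`, equivariantly
# ([MumfordAV1970] §7 Thm. 4, §12; [GortzWedhorn2020] (4.15), Def. 4.45 (2); [SGA1] VIII Thm. 5.2)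

Topic `Literature/AlgebraicGeometry/AbelianSchemes`; namespace `Literature.AlgebraicGeometry.AbelianSchemes.AbelianSchemeOver`.  THEOREMS ONLY (no
definition, no instance, no notation, no named fact, no `sorry`).  Cell `hodgecm-mathlib` (D-0151), programme P6 «MOD» (crux hLiu418 =
stmt-HodgeConjecture-24832, `--supports`, count-neutral): organ **(ii) «QUOTIENT ∕ KERNEL FORMATION COMMUTES WITH THE SPECIAL FIBRE, EQUIVARIANCE CARRIED»**
of the L2 closer `stub_SPEC` (LA2-plan (g0) deal 2026-09-02T03:20Z to LA1-p02 (g2); consumer LA2-p02 (g0)՚s LS-leaflet §3 `red₀Of_quotΩ_eq_of_spGeoOf_eq₂` ∕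
`RedHomLaw` ∕ `QuotWellDefLaw`: the reduced quotient point `red₀ (quotΩ y L)` depends only on `(red₀ y, 𝓛_s)`).  HC_CM is proved only modulo the printed
citations until rung 0 closes; this file is generic and changes no count.

THE MATHEMATICS.  Let `ψ : A → B` be a homomorphism of abelian schemes over `S` and `ι : G → A` an `S`-morphism with the KERNEL CLAUSE on all
`T`-valued points: «`t : T → A` factors through `ι` iff `t ≫ ψ = 1`» (binder `incl`; so `G` represents the kernel subfunctor of `ψ`; e.g. `incl = kerι ψ`, or the closure
`𝓛 ↪ 𝒜` of a generic line for the quotient isogeny `ψ = d ∘ q` it defines).  Let `g : S′ → S` be any base change (the special fibre: `g` the closed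
point).  (§1) The base change `ι_{S′} : G_{S′} → A_{S′}` has the kernel clause for `ψ_{S′} : A_{S′} → B_{S′}`: kernels commute with base change
([GortzWedhorn2020] (4.15), Def. 4.45 (2); ★ `GroupSchemeKernel.baseChangeIso`), and the clause moves between `G` and `Ker ψ` by the two
factorisations it provides (no monomorphism hypothesis is needed).  (§2) `ψ_{S′}` is a homomorphism, `𝒪`-equivariant for the base-changed actions when
`ψ` is (`ι_{S′}(a) = ι(a)_{S′}`, ★ `RingAction.baseChange_i`), and flat ∕ surjective ∕ quasi-compact when `ψ` is (its underlying map is a base change of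
`ψ.left`, ★ `Limits.isPullback_pullback_map_left`; [EGAIV2] Prop. 2.3.4 ∕ [GortzWedhorn2020] Prop. 4.32, Prop. 14.11).  (§3) HEAD: consequently, by the
uniqueness of fppf quotients with a given kernel ([MumfordAV1970] §7 Thm. 4; ★ `exists_iso_comp_eq_of_comp_eq_one_iff`), ANY fppf homomorphism
`φ′ : A_{S′} → C′` whose kernel clause is carried by `ι_{S′}` is isomorphic to `ψ_{S′}` under `A_{S′}`, by a unique isomorphism, which is a homomorphism and
is `𝒪`-equivariant when `φ′` is — «THE BASE CHANGE OF THE QUOTIENT `A → A⁄G` IS THE QUOTIENT OF THE BASE CHANGE BY `G_{S′}`».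

## Contents (`ψ′ := (Over.pullback g).map ψ : (A.baseChange g).X ⟶ (B.baseChange g).X`, `ι′ := (Over.pullback g).map ι`)
* §1 `comp_eq_one_of_kernelClause` (`ι ≫ ψ = 1`), `exists_comp_eq_kerι_of_kernelClause`, `exists_comp_map_kerι_iff` (the clause on `(kerι ψ)_{S′}`),
  **`exists_comp_pullback_map_iff_of_kernelClause`** (the clause on `ι_{S′}` for `ψ_{S′}`).
* §2 `pullback_map_comp_eq_of_comp_eq` (any commuting square is carried), **`pullback_map_equivariant`** (`𝒪`-equivariance is carried),
  `flat_pullback_map_left`, `surjective_pullback_map_left`, `quasiCompact_pullback_map_left`.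
* §3 HEAD **`exists_iso_pullback_map_comp_eq_of_kernelClause`** and its `𝒪`-equivariant twin **`exists_iso_pullback_map_comp_eq_equivariant_of_kernelClause`**.

## References
* [MumfordAV1970] D. Mumford, *Abelian Varieties* (1970), §7 Thm. 4 (p. 72); §12 (quotients by finite group schemes, pp. 109–123).
* [GortzWedhorn2020] U. Görtz, T. Wedhorn, *Algebraic Geometry I*, 2nd ed. (2020), (4.15) (p. 116), Definition 4.45 (2) (p. 117), Prop. 4.32, Prop. 14.11.
* [SGA1] A. Grothendieck, *SGA 1*, Exp. VIII Thm. 5.2 (fpqc descent of morphisms).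
* [EGAIV2] A. Grothendieck, J. Dieudonné, *ÉGA* IV₂ (1965), Prop. 2.3.4 (base change of flat ∕ surjective morphisms).
-/

set_option autoImplicit false
set_option backward.isDefEq.respectTransparency false -- `(A.baseChange g).grpObj` vs Mathlib `Functor.grpObjObj` (defeq by `rfl`, ★ `AbelianSchemeOverBase`)

noncomputable section

universe u

open CategoryTheory CategoryTheory.Limits AlgebraicGeometry MonoidalCategory CartesianMonoidalCategory
open scoped MonObj CategoryTheory.Obj
open Literature.AlgebraicGeometry.GroupSchemes Literature.AlgebraicGeometry.GroupSchemes.GroupSchemeKernel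

namespace Literature.AlgebraicGeometry.AbelianSchemes

namespace AbelianSchemeOver

variable {S S' : Scheme.{u}} (g : S' ⟶ S) {A B : AbelianSchemeOver S} (ψ : A.X ⟶ B.X) [IsMonHom ψ]
  {G : Over S} (incl : G ⟶ A.X)

/-! ## §1 The kernel clause and its base change -/

section KernelClause

variable (hG : ∀ ⦃T : Over S⦄ (t : T ⟶ A.X), (∃ s : T ⟶ G, s ≫ incl = t) ↔ t ≫ ψ = 1)
include hG

omit [IsMonHom ψ] in
/-- `ι ≫ ψ = 1` (the clause at `t := ι`, `s := 𝟙`). [cite: GortzWedhorn2020, Definition 4.45 (2) (p. 117)] -/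
theorem comp_eq_one_of_kernelClause : incl ≫ ψ = 1 :=
  (hG incl).1 ⟨𝟙 G, Category.id_comp incl⟩

omit [IsMonHom ψ] in
/-- `Ker ψ ↪ A` factors through `ι` (the clause at `t := kerι ψ`, ★ `kerι_comp`). [cite: GortzWedhorn2020, Definition 4.45 (2) (p. 117)] -/
theorem exists_comp_eq_kerι_of_kernelClause : ∃ s₀ : ker ψ ⟶ G, s₀ ≫ incl = kerι ψ :=
  (hG (kerι ψ)).2 (kerι_comp ψ)

omit hG [IsMonHom ψ] in
/-- **The kernel clause on `(Ker ψ)_{S′} → A_{S′}` for `ψ_{S′}`**: a point `t′ : T′ → A_{S′}` factors through `(kerι ψ)_{S′}` iff `t′ ≫ ψ_{S′} = 1` — kernels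
commute with base change (★ `GroupSchemeKernel.baseChangeIso`, `baseChangeIso_hom_comp_kerι`, `baseChangeIso_inv_comp_map_kerι`) and the universal property of
`Ker ψ_{S′}` (★ `kerLift`, `kerι_comp`). [cite: GortzWedhorn2020, (4.15) (p. 116) and Definition 4.45 (2) (p. 117)] -/
theorem exists_comp_map_kerι_iff {T' : Over S'} (t' : T' ⟶ (A.baseChange g).X) :
    (∃ k : T' ⟶ (Over.pullback g).obj (ker ψ), k ≫ (Over.pullback g).map (kerι ψ) = t') ↔
      t' ≫ (Over.pullback g).map ψ = (1 : T' ⟶ (B.baseChange g).X) := by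
  constructor
  · rintro ⟨k, rfl⟩
    rw [Category.assoc, ← Functor.map_comp, kerι_comp, pullback_map_one g, MonObj.comp_one]
  · intro h
    refine ⟨kerLift t' h ≫ (GroupSchemeKernel.baseChangeIso g ψ).inv, ?_⟩
    rw [Category.assoc, GroupSchemeKernel.baseChangeIso_inv_comp_map_kerι, kerLift_ι]

omit [IsMonHom ψ] in
/-- **THE KERNEL CLAUSE COMMUTES WITH BASE CHANGE**: if `ι : G → A` carries the kernel clause of `ψ` on all `T`-points over `S`, then
`ι_{S′} : G_{S′} → A_{S′}` carries the kernel clause of `ψ_{S′}` on all `T′`-points over `S′` (`G` and `Ker ψ` factor through each other over `A`, so do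
their base changes; then `exists_comp_map_kerι_iff`).  No monomorphism hypothesis on `ι`. [cite: GortzWedhorn2020, (4.15) (p. 116) and Definition 4.45 (2) (p. 117)]
[cite: MumfordAV1970, §12 (p. 109)] -/
theorem exists_comp_pullback_map_iff_of_kernelClause {T' : Over S'} (t' : T' ⟶ (A.baseChange g).X) :
    (∃ s' : T' ⟶ (Over.pullback g).obj G, s' ≫ (Over.pullback g).map incl = t') ↔
      t' ≫ (Over.pullback g).map ψ = (1 : T' ⟶ (B.baseChange g).X) := by
  refine Iff.trans ?_ (exists_comp_map_kerι_iff g ψ t')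
  obtain ⟨s₀, hs₀⟩ := exists_comp_eq_kerι_of_kernelClause ψ incl hG
  have hιψ : incl ≫ ψ = 1 := comp_eq_one_of_kernelClause ψ incl hG
  constructor
  · rintro ⟨s', rfl⟩
    refine ⟨s' ≫ (Over.pullback g).map (kerLift incl hιψ), ?_⟩
    rw [Category.assoc, ← Functor.map_comp, kerLift_ι]
  · rintro ⟨k, rfl⟩
    refine ⟨k ≫ (Over.pullback g).map s₀, ?_⟩
    rw [Category.assoc, ← Functor.map_comp, hs₀]

end KernelClause

/-! ## §2 The base-changed homomorphism: commuting squares, equivariance, fppf properties -/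

omit [IsMonHom ψ] in
/-- **Commuting squares are carried by base change**: `α ≫ ψ = ψ ≫ β ⇒ α_{S′} ≫ ψ_{S′} = ψ_{S′} ≫ β_{S′}` (functoriality of `Over.pullback g`).
[cite: GortzWedhorn2020, (4.15) (p. 116)] -/
theorem pullback_map_comp_eq_of_comp_eq {α : A.X ⟶ A.X} {β : B.X ⟶ B.X} (h : α ≫ ψ = ψ ≫ β) :
    (Over.pullback g).map α ≫ (Over.pullback g).map ψ = (Over.pullback g).map ψ ≫ (Over.pullback g).map β := by
  rw [← Functor.map_comp, h, Functor.map_comp]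

omit [IsMonHom ψ] in
/-- **`𝒪`-EQUIVARIANCE IS CARRIED**: if `ψ` intertwines the actions `actA`, `actB` (`ι_A(a) ≫ ψ = ψ ≫ ι_B(a)`), then `ψ_{S′}` intertwines the
base-changed actions (★ `RingAction.baseChange_i`: `ι_{S′}(a) = ι(a)_{S′}`). [cite: GortzWedhorn2020, (4.15) (p. 116)] [cite: MumfordAV1970, §7 Thm. 4 (p. 72)] -/
theorem pullback_map_equivariant {O : Type*} [CommRing O] (actA : A.RingAction O) (actB : B.RingAction O)
    (hψ : ∀ a, actA.i a ≫ ψ = ψ ≫ actB.i a) (a : O) :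
    (actA.baseChange g).i a ≫ (Over.pullback g).map ψ = (Over.pullback g).map ψ ≫ (actB.baseChange g).i a := by
  rw [RingAction.baseChange_i, RingAction.baseChange_i]
  exact pullback_map_comp_eq_of_comp_eq g ψ (hψ a)

omit [IsMonHom ψ] in
/-- `ψ_{S′}.left` is FLAT when `ψ.left` is (a base change of `ψ.left`, ★ `Limits.isPullback_pullback_map_left`; Mathlib `Flat.isStableUnderBaseChange`).
[cite: EGAIV2, Prop. 2.3.4] [cite: GortzWedhorn2020, Prop. 14.11] -/
theorem flat_pullback_map_left [Flat ψ.left] : Flat ((Over.pullback g).map ψ).left :=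
  MorphismProperty.of_isPullback (P := @Flat) (Literature.AlgebraicGeometry.Limits.isPullback_pullback_map_left g ψ).flip ‹_›

omit [IsMonHom ψ] in
/-- `ψ_{S′}.left` is SURJECTIVE when `ψ.left` is (Mathlib `IsStableUnderBaseChange @Surjective`). [cite: EGAIV2, Prop. 2.3.4] [cite: GortzWedhorn2020, Prop. 4.32] -/
theorem surjective_pullback_map_left [Surjective ψ.left] : Surjective ((Over.pullback g).map ψ).left :=
  MorphismProperty.of_isPullback (P := @Surjective) (Literature.AlgebraicGeometry.Limits.isPullback_pullback_map_left g ψ).flip ‹_›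

omit [IsMonHom ψ] in
/-- `ψ_{S′}.left` is QUASI-COMPACT when `ψ.left` is (Mathlib `quasiCompact_isStableUnderBaseChange`). [cite: GortzWedhorn2020, Prop. 4.32] -/
theorem quasiCompact_pullback_map_left [QuasiCompact ψ.left] : QuasiCompact ((Over.pullback g).map ψ).left :=
  MorphismProperty.of_isPullback (P := @QuasiCompact) (Literature.AlgebraicGeometry.Limits.isPullback_pullback_map_left g ψ).flip ‹_›

/-! ## §3 HEAD: the base-changed quotient is the quotient of the base change -/

section Head

variable (hG : ∀ ⦃T : Over S⦄ (t : T ⟶ A.X), (∃ s : T ⟶ G, s ≫ incl = t) ↔ t ≫ ψ = 1)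
  [Flat ψ.left] [Surjective ψ.left] [QuasiCompact ψ.left]
  {C' : AbelianSchemeOver S'} (φ' : (A.baseChange g).X ⟶ C'.X) [IsMonHom φ'] [Flat φ'.left] [Surjective φ'.left] [QuasiCompact φ'.left]
  (hφ' : ∀ ⦃T' : Over S'⦄ (t' : T' ⟶ (A.baseChange g).X),
    (∃ s' : T' ⟶ (Over.pullback g).obj G, s' ≫ (Over.pullback g).map incl = t') ↔ t' ≫ φ' = 1)
include hG hφ'

/-- **THE QUOTIENT WITH GIVEN KERNEL COMMUTES WITH BASE CHANGE** ([MumfordAV1970] §7 Thm. 4 + [GortzWedhorn2020] Def. 4.45 (2)): let `ψ : A → B` be an fppf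
homomorphism of abelian schemes over `S` (flat, surjective, quasi-compact) with kernel clause carried by `ι : G → A`, `g : S′ → S` a base change, and
`φ′ : A_{S′} → C′` ANY fppf homomorphism whose kernel clause is carried by `ι_{S′} : G_{S′} → A_{S′}`.  Then there is an isomorphism `e : B_{S′} ≅ C′` over `S′`
with `ψ_{S′} ≫ e = φ′`; it is a homomorphism and the unique factorisation.  (§1 puts the kernel clause of `ψ_{S′}` on `ι_{S′}`, §2 makes `ψ_{S′}` fppf; then ★
`exists_iso_comp_eq_of_comp_eq_one_iff` over `S′`.)  For `g` the closed point of a valuation ring: «the special fibre of `A ⁄ G` is `A_s ⁄ G_s`».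
[cite: MumfordAV1970, §7 Thm. 4 (p. 72)] [cite: GortzWedhorn2020, Definition 4.45 (2) (p. 117)] [cite: SGA1, Exp. VIII Thm. 5.2] -/
theorem exists_iso_pullback_map_comp_eq_of_kernelClause :
    ∃ e : (B.baseChange g).X ≅ C'.X, (Over.pullback g).map ψ ≫ e.hom = φ' ∧ IsMonHom e.hom ∧
      ∀ χ : (B.baseChange g).X ⟶ C'.X, (Over.pullback g).map ψ ≫ χ = φ' → χ = e.hom := by
  haveI : IsMonHom (M := (A.baseChange g).X) (N := (B.baseChange g).X) ((Over.pullback g).map ψ) :=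
    isMonHom_pullback_map g ψ
  haveI := flat_pullback_map_left g ψ
  haveI := surjective_pullback_map_left g ψ
  haveI := quasiCompact_pullback_map_left g ψ
  exact (A.baseChange g).exists_iso_comp_eq_of_comp_eq_one_iff (C := B.baseChange g) ((Over.pullback g).map ψ) φ'
    fun T' t' => (exists_comp_pullback_map_iff_of_kernelClause g ψ incl hG t').symm.trans (hφ' t')

/-- **… EQUIVARIANTLY**: with `𝒪`-actions `actA` on `A`, `actB` on `B`, `actC′` on `C′`, if `ψ` is equivariant and `φ′` is equivariant for the base-changed
action `actA.baseChange g`, then the isomorphism `e : B_{S′} ≅ C′` of `exists_iso_pullback_map_comp_eq_of_kernelClause` intertwines `actB.baseChange g` and `actC′`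
(§2 `pullback_map_equivariant` + ★ `exists_iso_comp_eq_equivariant_of_comp_eq_one_iff`) — the `𝒪`-abelian scheme `(A ⁄ G)_{S′}` IS `A_{S′} ⁄ G_{S′}`.
[cite: MumfordAV1970, §7 Thm. 4 (p. 72)] [cite: GortzWedhorn2020, Definition 4.45 (2) (p. 117)] [cite: SGA1, Exp. VIII Thm. 5.2] -/
theorem exists_iso_pullback_map_comp_eq_equivariant_of_kernelClause {O : Type*} [CommRing O] (actA : A.RingAction O)
    (actB : B.RingAction O) (actC' : C'.RingAction O) (hψ : ∀ a, actA.i a ≫ ψ = ψ ≫ actB.i a)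
    (hφ'eq : ∀ a, (actA.baseChange g).i a ≫ φ' = φ' ≫ actC'.i a) :
    ∃ e : (B.baseChange g).X ≅ C'.X, (Over.pullback g).map ψ ≫ e.hom = φ' ∧ IsMonHom e.hom ∧
      (∀ a, (actB.baseChange g).i a ≫ e.hom = e.hom ≫ actC'.i a) ∧
        ∀ χ : (B.baseChange g).X ⟶ C'.X, (Over.pullback g).map ψ ≫ χ = φ' → χ = e.hom := by
  haveI : IsMonHom (M := (A.baseChange g).X) (N := (B.baseChange g).X) ((Over.pullback g).map ψ) :=
    isMonHom_pullback_map g ψ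
  haveI := flat_pullback_map_left g ψ
  haveI := surjective_pullback_map_left g ψ
  haveI := quasiCompact_pullback_map_left g ψ
  exact exists_iso_comp_eq_equivariant_of_comp_eq_one_iff (A := A.baseChange g) (B := C') (C := B.baseChange g)
    (ψ := (Over.pullback g).map ψ) (φ := φ') (actA := actA.baseChange g) (actB := actC') (actC := actB.baseChange g)
    (pullback_map_equivariant g ψ actA actB hψ) hφ'eq
    fun T' t' => (exists_comp_pullback_map_iff_of_kernelClause g ψ incl hG t').symm.trans (hφ' t')

end Head

end AbelianSchemeOver

end Literature.AlgebraicGeometry.AbelianSchemes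

end
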